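import Summits.BirchSwinnertonDyer.BirchSwinnertonDyer.Theorems.SignedLowerHalvesSprungLowerDivisibilityAtThreeIotaDoorContraOrbit
import Summits.BirchSwinnertonDyer.BirchSwinnertonDyer.Theorems.SignedLowerHalvesSprungLowerDivisibilityAtThreeIotaDoorContraClosedOfThm714
import Summits.BirchSwinnertonDyer.BirchSwinnertonDyer.Theorems.SignedLowerHalvesSprungLowerDivisibilityAtThreeStubPeriodMu
import HarnessLib

/-!
# Crux `SprungLowerDivisibilityAtThree` (item stmt-BirchSwinnertonDyer-19875; twin route `PrintX8VSC`: crux K′ 23732), line `chromatic-common-zeros`: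
# THE ORBIT FORM OF THE PRINT-KEYED `ι`-DOOR, part 3 — over the K′ BINDER TELESCOPE: from ANY door of the registered shape, the door AT THE
# MIRROR prime (equivalently: a mirror prime WITHOUT zeta index) already gives Kato's fine inequality at `𝔭`; instantiated on the born pack

Cell `bsd-ssimc` (host), width seat `cruxlead-stmt-BirchSwinnertonDyer-19875-w2` (gen 12) under the 19875 LEAD; `--supports`
stmt-BirchSwinnertonDyer-19875 `--as helper`; theorems only (no `def`, no named fact, no instance); closes NO item. Sequel of
`…IotaDoorContraOrbit` (same seat). The K′ binder telescope is the one of the REGISTERED line skeleton on item 23732 (LEAD g7; tree copy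
`Cruxes/SprungLowerDivisibilityAtThree/Lines/twinC_Kprime_iota_door_contra_LEADg7.lean`): X8 pair, cyclotomic/Honda setting, newform `f` with
period ratio `ϖ`, Sprung pair, Kato datum `I`, JOINT contragredient Coleman–Kato packages `Cs, Cf` (`Cs.Z = Cf.Z`), natural-keyed fine datum
`Y′ : FineSelmerDualData κ γ⁻¹`, a sporadic height-one `𝔭` (`p ∉ 𝔭`, no `ω̃ₙ ∈ 𝔭`) that is a common zero of both Néron-normalised colours.
Notation: `k = ℓ_𝔭(I.H ⧸ Cs.Z)`, `j = min_• ℓ_𝔭(Λ ⧸ range C•.colMap)`, `x′ = ℓ_𝔭 Y′.X`, `ι𝔭 = PrimeSpectrum.comap (invol p) 𝔭`, `k′ = k(ι𝔭)`, `j′ = j(ι𝔭)`.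

* `katoFineLowerSporadic_contra_of_mirrorDoor` — DISPLAYED `hdoor` = any theorem of the registered door shape («… common zero at `𝔭`, `k ≤ j′`
  ⟹ `k ≤ x′`», e.g. `iotaDoorContra_sporadic_of_heldPack_of_thm714 hPT h124 hMatar h714`, LEAD g7 p675240, or a successor without Kato's Thm. 12.4
  once w3 g10's `cokerBoundIotaOffT_contra_of_poitouTate_of_thm714'` is threaded) and the period unit at `3` (`h3`, so that Néron-normalised
  generators exist: `stub_periodMu`): over the telescope, **`k′ ≤ j` (the door AT THE MIRROR) ⟹ `k ≤ x′` AT `𝔭`** — by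
  `ClassX8`-discharged `iotaDoor_contra_iff_comap_invol` (door(ι𝔭) ⟺ door(𝔭)).
* `katoFineLowerSporadic_contra_of_zeta_comap_invol_eq_zero` — same inputs: **`k′ = 0 ⟹ k ≤ x′`**.
* `katoFineLowerSporadic_contra_of_mirrorDoor_of_heldPack_of_thm714`, `katoFineLowerSporadic_contra_of_zeta_comap_invol_eq_zero_of_heldPack_of_thm714`:
  the instances on the BORN guard pack of route PrintX8VSC (PT functional model ∧ Kato 12.4 ∧ Matar 1.1) + Sprung Thm. 7.14 + the period unit.

HONEST FRAMING: book-keeping over landed theorems; nothing is discharged; the door's inputs are printed theorems typed statement-only; the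
residue stub `stub_iotaResidueContra`, K′, C′, K1, leaf X8 and BSD are NOT proved. WHAT IT SAYS: the registered residue `j′ < k` of K′ may be
read on the `ι`-ORBIT — a sporadic common zero is in the residue iff its mirror is, and then BOTH carry positive zeta index.

References: [Kato2004Asterisque] Thm. 12.4 (p. 221), Conj. 12.10 (p. 224), Thm. 12.6 (p. 222), (17.13.1) (pp. 279–280); [Sprung2012] Def. 6.1,
§7.1 Props. 7.3/7.6, Thm. 7.14 (3) (p. 1504), Main Conj. 7.21 (p. 1505); [Sprung2017] Thm. 4.13, Cor. 4.14; [Matar2020] Thm. 1.1;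
[Wingberg1989] Cor. 2.5; [GreenbergVatsal2000] §3 Rem. 3.4 (period unit); tree: `…IotaDoorContraOrbit`, `…IotaDoorContraClosedOfThm714`,
`…StubPeriodMu`, `…KatoSporadicLedgerIota`.
-/

set_option linter.dupNamespace false
set_option autoImplicit false

noncomputable section

open scoped Classical NumberField MatrixGroups ModularForm

open NumberField IsDedekindDomain CongruenceSubgroup WeierstrassCurve Field
  Literature.NumberTheory.EllipticCurves Literature.NumberTheory.EllipticCurves.ModularForms
  Literature.NumberTheory.EllipticCurves.ZpExtension Literature.NumberTheory.EllipticCurves.Sprung2017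
  Literature.NumberTheory.EllipticCurves.Sprung2012 Literature.NumberTheory.EllipticCurves.Rank1Residual
  Literature.NumberTheory.EllipticCurves.IwasawaAlgebra Literature.NumberTheory.EllipticCurves.Kato2004
  Literature.NumberTheory.EllipticCurves.Module
  Summit.BirchSwinnertonDyer.BirchSwinnertonDyer.Theorems

namespace Summit.BirchSwinnertonDyer.BirchSwinnertonDyer.Theorems.ChromaticCommonZeros

/-- **DOOR AT THE MIRROR ⟹ K AT `𝔭`, over the K′ binder telescope (print keying).** DISPLAYED: `hdoor`, any theorem of the registered door
shape of the K′ line skeleton (sporadic common zero `𝔭`, `k(𝔭) ≤ j(ι𝔭)` ⟹ `k(𝔭) ≤ x′(𝔭)`), and the period unit at `3` (`h3`). THEN over the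
same telescope the door AT THE MIRROR PRIME, `k(ι𝔭) ≤ j(𝔭)`, already gives Kato's fine inequality `k(𝔭) ≤ x′(𝔭)` — because on class X8
door(ι𝔭) ⟺ door(𝔭) (`iotaDoor_contra_iff_comap_invol`; `ι`-stability of `(L♯, L♭)`, both colours non-zero, `E[3]` irreducible and the
existence of Néron-normalised generators are tree theorems / `stub_periodMu h3`).
[cite: Kato2004Asterisque, Conj. 12.10 (p. 224), Thm. 12.6 (p. 222), (17.13.1) (p. 280)] [cite: Sprung2012, Def. 6.1, §7.1, Thm. 7.14 (3) (p. 1504)]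
[cite: Sprung2017, Thm. 4.13, Cor. 4.14] [cite: GreenbergVatsal2000, §3, Remark 3.4] -/
theorem katoFineLowerSporadic_contra_of_mirrorDoor (h3 : realPeriodRat_eq_unit_mul_plusPeriod_three)
    (hdoor : ∀ (W : WeierstrassCurve ℚ) [W.IsElliptic] [W.IsGloballyMinimal] (p : ℕ) [Fact p.Prime]
      [ContinuousSMul ℤ_[p] (W.tateModule p)] [Module.Free ℤ_[p] (W.tateModule p)]
      [Module.Finite ℤ_[p] (W.tateModule p)],
      ClassX8 W p → ∀ (κ : ZpExtension ℚ p) (γ : Field.absoluteGaloisGroup ℚ),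
      κ.IsCyclotomic → κ.IsTopGenerator γ → IsCyclotomicVariable p γ →
    ∀ (v : HeightOneSpectrum (𝓞 ℚ)), (p : 𝓞 ℚ) ∈ v.asIdeal →
    ∀ (g : Field.absoluteGaloisGroup (v.adicCompletion ℚ)),
      κ.IsTopGenerator (resGalOfEmb (closureEmb (K := ℚ) (v.adicCompletion ℚ)) g) →
    ∀ (cneg : localPoints W (v.adicCompletion ℚ)) (c : ℕ → localPoints W (v.adicCompletion ℚ)),
      IsHondaSystem κ (closureEmb (K := ℚ) (v.adicCompletion ℚ)) W (W.frobeniusTrace p) g cneg c →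
    ∀ (N : ℕ) (_ : NeZero N) (f : CuspForm (Gamma0 N) 2) (ϖ : ℚ) (Lsharp Lflat : IwasawaAlgebra p),
      IsNewformOf W f → (ϖ : ℝ) * W.realPeriodRat = plusPeriod f →
      IsSprungPair f p (W.frobeniusTrace p) Lsharp Lflat →
    ∀ (I : Kato2004.IwasawaH1Data W p κ γ)
      (Cs : SharpFlatColemanKatoDataContra W p f ϖ κ γ (closureEmb (K := ℚ) (v.adicCompletion ℚ))
        (W.frobeniusTrace p) g c Chroma.sharp I)
      (Cf : SharpFlatColemanKatoDataContra W p f ϖ κ γ (closureEmb (K := ℚ) (v.adicCompletion ℚ))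
        (W.frobeniusTrace p) g c Chroma.flat I),
      Cs.Z = Cf.Z →
    ∀ (Y : W.FineSelmerDualData κ γ⁻¹) (𝔭 : PrimeSpectrum (IwasawaAlgebra p)), 𝔭.asIdeal.height = 1 →
      (p : IwasawaAlgebra p) ∉ 𝔭.asIdeal →
      (¬ ∃ n : ℕ, ((cyclotomicOmega p n).map (Int.castRingHom ℤ_[p]) : PowerSeries ℤ_[p]) ∈ 𝔭.asIdeal) →
      (∀ (col' : Chroma) (G' : IwasawaAlgebra p),
        iwasawaToPowerSeries p G' =
          PowerSeries.C (ϖ : ℚ_[p]) * iwasawaToPowerSeries p (chromaticL col' Lsharp Lflat) →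
        G' ∈ 𝔭.asIdeal) →
      Module.lengthAt (IwasawaAlgebra p) (I.H ⧸ Cs.Z) 𝔭 ≤
          min (Module.lengthAt (IwasawaAlgebra p) (IwasawaAlgebra p ⧸ LinearMap.range Cs.colMap)
                (PrimeSpectrum.comap (invol p).toRingHom 𝔭))
            (Module.lengthAt (IwasawaAlgebra p) (IwasawaAlgebra p ⧸ LinearMap.range Cf.colMap)
                (PrimeSpectrum.comap (invol p).toRingHom 𝔭)) →
      Module.lengthAt (IwasawaAlgebra p) (I.H ⧸ Cs.Z) 𝔭 ≤ Module.lengthAt (IwasawaAlgebra p) Y.X 𝔭) :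
    ∀ (W : WeierstrassCurve ℚ) [W.IsElliptic] [W.IsGloballyMinimal] (p : ℕ) [Fact p.Prime]
      [ContinuousSMul ℤ_[p] (W.tateModule p)] [Module.Free ℤ_[p] (W.tateModule p)]
      [Module.Finite ℤ_[p] (W.tateModule p)],
      ClassX8 W p → ∀ (κ : ZpExtension ℚ p) (γ : Field.absoluteGaloisGroup ℚ),
      κ.IsCyclotomic → κ.IsTopGenerator γ → IsCyclotomicVariable p γ →
    ∀ (v : HeightOneSpectrum (𝓞 ℚ)), (p : 𝓞 ℚ) ∈ v.asIdeal →
    ∀ (g : Field.absoluteGaloisGroup (v.adicCompletion ℚ)),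
      κ.IsTopGenerator (resGalOfEmb (closureEmb (K := ℚ) (v.adicCompletion ℚ)) g) →
    ∀ (cneg : localPoints W (v.adicCompletion ℚ)) (c : ℕ → localPoints W (v.adicCompletion ℚ)),
      IsHondaSystem κ (closureEmb (K := ℚ) (v.adicCompletion ℚ)) W (W.frobeniusTrace p) g cneg c →
    ∀ (N : ℕ) (_ : NeZero N) (f : CuspForm (Gamma0 N) 2) (ϖ : ℚ) (Lsharp Lflat : IwasawaAlgebra p),
      IsNewformOf W f → (ϖ : ℝ) * W.realPeriodRat = plusPeriod f →
      IsSprungPair f p (W.frobeniusTrace p) Lsharp Lflat →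
    ∀ (I : Kato2004.IwasawaH1Data W p κ γ)
      (Cs : SharpFlatColemanKatoDataContra W p f ϖ κ γ (closureEmb (K := ℚ) (v.adicCompletion ℚ))
        (W.frobeniusTrace p) g c Chroma.sharp I)
      (Cf : SharpFlatColemanKatoDataContra W p f ϖ κ γ (closureEmb (K := ℚ) (v.adicCompletion ℚ))
        (W.frobeniusTrace p) g c Chroma.flat I),
      Cs.Z = Cf.Z →
    ∀ (Y : W.FineSelmerDualData κ γ⁻¹) (𝔭 : PrimeSpectrum (IwasawaAlgebra p)), 𝔭.asIdeal.height = 1 →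
      (p : IwasawaAlgebra p) ∉ 𝔭.asIdeal →
      (¬ ∃ n : ℕ, ((cyclotomicOmega p n).map (Int.castRingHom ℤ_[p]) : PowerSeries ℤ_[p]) ∈ 𝔭.asIdeal) →
      (∀ (col' : Chroma) (G' : IwasawaAlgebra p),
        iwasawaToPowerSeries p G' =
          PowerSeries.C (ϖ : ℚ_[p]) * iwasawaToPowerSeries p (chromaticL col' Lsharp Lflat) →
        G' ∈ 𝔭.asIdeal) →
      Module.lengthAt (IwasawaAlgebra p) (I.H ⧸ Cs.Z) (PrimeSpectrum.comap (invol p).toRingHom 𝔭) ≤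
          min (Module.lengthAt (IwasawaAlgebra p) (IwasawaAlgebra p ⧸ LinearMap.range Cs.colMap) 𝔭)
            (Module.lengthAt (IwasawaAlgebra p) (IwasawaAlgebra p ⧸ LinearMap.range Cf.colMap) 𝔭) →
      Module.lengthAt (IwasawaAlgebra p) (I.H ⧸ Cs.Z) 𝔭 ≤ Module.lengthAt (IwasawaAlgebra p) Y.X 𝔭 := by
  intro W _ _ p _ _ _ _ hX κ γ hκ hγ hcv v hv g hg cneg c hH N hN f ϖ Lsharp Lflat hf hϖ hSP I Cs Cf hZ Y 𝔭 h𝔭 hp𝔭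
    hspor hcommon hmirror
  haveI : NeZero N := hN
  obtain ⟨hs0, hf0⟩ :=
    ChromaticBothColours.ClassX8.sharp_ne_zero_and_flat_ne_zero W p hX N inferInstance f Lsharp Lflat hf hSP
  obtain ⟨hG, -⟩ := stub_periodMu h3 W p hX N hN f ϖ Lsharp Lflat hf hϖ hSP
  obtain ⟨Gs, hGs⟩ := hG Chroma.sharp
  obtain ⟨Gf, hGf⟩ := hG Chroma.flat
  have hdoor𝔭 := (iotaDoor_contra_iff_comap_invol W p Cs Cf hZ (ClassX8.irr' W p hX) (hf.periodRatio_ne_zero hϖ) hSP hs0 hf0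
    hGs hGf (ClassX8.invol_mem_span_pair W p hX f Lsharp Lflat hf hSP) 𝔭 h𝔭 hp𝔭).mpr hmirror
  exact hdoor W p hX κ γ hκ hγ hcv v hv g hg cneg c hH N hN f ϖ Lsharp Lflat hf hϖ hSP I Cs Cf hZ Y 𝔭 h𝔭 hp𝔭 hspor hcommon hdoor𝔭

/-- **A MIRROR WITHOUT ZETA INDEX ⟹ K AT `𝔭`, over the K′ binder telescope (print keying).** Same DISPLAYED inputs (`hdoor` of the registered
door shape, the period unit `h3`): over the telescope, **`k(ι𝔭) = 0 ⟹ k(𝔭) ≤ x′(𝔭)`** — a sporadic common zero whose mirror prime is prime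
to the index of Kato's zeta element in `𝐇¹` satisfies Kato's Main Conjecture 12.10 ⊆ at `𝔭` from the door alone; the registered residue
`stub_iotaResidueContra` lives on the `ι`-orbits where BOTH members carry positive zeta index.
[cite: Kato2004Asterisque, Conj. 12.10 (p. 224), Thm. 12.6 (p. 222), (17.13.1) (p. 280)] [cite: Sprung2012, Def. 6.1, §7.1, Thm. 7.14 (3) (p. 1504)]
[cite: Sprung2017, Thm. 4.13, Cor. 4.14] [cite: GreenbergVatsal2000, §3, Remark 3.4] -/
theorem katoFineLowerSporadic_contra_of_zeta_comap_invol_eq_zero (h3 : realPeriodRat_eq_unit_mul_plusPeriod_three)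
    (hdoor : ∀ (W : WeierstrassCurve ℚ) [W.IsElliptic] [W.IsGloballyMinimal] (p : ℕ) [Fact p.Prime]
      [ContinuousSMul ℤ_[p] (W.tateModule p)] [Module.Free ℤ_[p] (W.tateModule p)]
      [Module.Finite ℤ_[p] (W.tateModule p)],
      ClassX8 W p → ∀ (κ : ZpExtension ℚ p) (γ : Field.absoluteGaloisGroup ℚ),
      κ.IsCyclotomic → κ.IsTopGenerator γ → IsCyclotomicVariable p γ →
    ∀ (v : HeightOneSpectrum (𝓞 ℚ)), (p : 𝓞 ℚ) ∈ v.asIdeal →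
    ∀ (g : Field.absoluteGaloisGroup (v.adicCompletion ℚ)),
      κ.IsTopGenerator (resGalOfEmb (closureEmb (K := ℚ) (v.adicCompletion ℚ)) g) →
    ∀ (cneg : localPoints W (v.adicCompletion ℚ)) (c : ℕ → localPoints W (v.adicCompletion ℚ)),
      IsHondaSystem κ (closureEmb (K := ℚ) (v.adicCompletion ℚ)) W (W.frobeniusTrace p) g cneg c →
    ∀ (N : ℕ) (_ : NeZero N) (f : CuspForm (Gamma0 N) 2) (ϖ : ℚ) (Lsharp Lflat : IwasawaAlgebra p),
      IsNewformOf W f → (ϖ : ℝ) * W.realPeriodRat = plusPeriod f →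
      IsSprungPair f p (W.frobeniusTrace p) Lsharp Lflat →
    ∀ (I : Kato2004.IwasawaH1Data W p κ γ)
      (Cs : SharpFlatColemanKatoDataContra W p f ϖ κ γ (closureEmb (K := ℚ) (v.adicCompletion ℚ))
        (W.frobeniusTrace p) g c Chroma.sharp I)
      (Cf : SharpFlatColemanKatoDataContra W p f ϖ κ γ (closureEmb (K := ℚ) (v.adicCompletion ℚ))
        (W.frobeniusTrace p) g c Chroma.flat I),
      Cs.Z = Cf.Z →
    ∀ (Y : W.FineSelmerDualData κ γ⁻¹) (𝔭 : PrimeSpectrum (IwasawaAlgebra p)), 𝔭.asIdeal.height = 1 →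
      (p : IwasawaAlgebra p) ∉ 𝔭.asIdeal →
      (¬ ∃ n : ℕ, ((cyclotomicOmega p n).map (Int.castRingHom ℤ_[p]) : PowerSeries ℤ_[p]) ∈ 𝔭.asIdeal) →
      (∀ (col' : Chroma) (G' : IwasawaAlgebra p),
        iwasawaToPowerSeries p G' =
          PowerSeries.C (ϖ : ℚ_[p]) * iwasawaToPowerSeries p (chromaticL col' Lsharp Lflat) →
        G' ∈ 𝔭.asIdeal) →
      Module.lengthAt (IwasawaAlgebra p) (I.H ⧸ Cs.Z) 𝔭 ≤
          min (Module.lengthAt (IwasawaAlgebra p) (IwasawaAlgebra p ⧸ LinearMap.range Cs.colMap)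
                (PrimeSpectrum.comap (invol p).toRingHom 𝔭))
            (Module.lengthAt (IwasawaAlgebra p) (IwasawaAlgebra p ⧸ LinearMap.range Cf.colMap)
                (PrimeSpectrum.comap (invol p).toRingHom 𝔭)) →
      Module.lengthAt (IwasawaAlgebra p) (I.H ⧸ Cs.Z) 𝔭 ≤ Module.lengthAt (IwasawaAlgebra p) Y.X 𝔭) :
    ∀ (W : WeierstrassCurve ℚ) [W.IsElliptic] [W.IsGloballyMinimal] (p : ℕ) [Fact p.Prime]
      [ContinuousSMul ℤ_[p] (W.tateModule p)] [Module.Free ℤ_[p] (W.tateModule p)]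
      [Module.Finite ℤ_[p] (W.tateModule p)],
      ClassX8 W p → ∀ (κ : ZpExtension ℚ p) (γ : Field.absoluteGaloisGroup ℚ),
      κ.IsCyclotomic → κ.IsTopGenerator γ → IsCyclotomicVariable p γ →
    ∀ (v : HeightOneSpectrum (𝓞 ℚ)), (p : 𝓞 ℚ) ∈ v.asIdeal →
    ∀ (g : Field.absoluteGaloisGroup (v.adicCompletion ℚ)),
      κ.IsTopGenerator (resGalOfEmb (closureEmb (K := ℚ) (v.adicCompletion ℚ)) g) →
    ∀ (cneg : localPoints W (v.adicCompletion ℚ)) (c : ℕ → localPoints W (v.adicCompletion ℚ)),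
      IsHondaSystem κ (closureEmb (K := ℚ) (v.adicCompletion ℚ)) W (W.frobeniusTrace p) g cneg c →
    ∀ (N : ℕ) (_ : NeZero N) (f : CuspForm (Gamma0 N) 2) (ϖ : ℚ) (Lsharp Lflat : IwasawaAlgebra p),
      IsNewformOf W f → (ϖ : ℝ) * W.realPeriodRat = plusPeriod f →
      IsSprungPair f p (W.frobeniusTrace p) Lsharp Lflat →
    ∀ (I : Kato2004.IwasawaH1Data W p κ γ)
      (Cs : SharpFlatColemanKatoDataContra W p f ϖ κ γ (closureEmb (K := ℚ) (v.adicCompletion ℚ))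
        (W.frobeniusTrace p) g c Chroma.sharp I)
      (Cf : SharpFlatColemanKatoDataContra W p f ϖ κ γ (closureEmb (K := ℚ) (v.adicCompletion ℚ))
        (W.frobeniusTrace p) g c Chroma.flat I),
      Cs.Z = Cf.Z →
    ∀ (Y : W.FineSelmerDualData κ γ⁻¹) (𝔭 : PrimeSpectrum (IwasawaAlgebra p)), 𝔭.asIdeal.height = 1 →
      (p : IwasawaAlgebra p) ∉ 𝔭.asIdeal →
      (¬ ∃ n : ℕ, ((cyclotomicOmega p n).map (Int.castRingHom ℤ_[p]) : PowerSeries ℤ_[p]) ∈ 𝔭.asIdeal) →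
      (∀ (col' : Chroma) (G' : IwasawaAlgebra p),
        iwasawaToPowerSeries p G' =
          PowerSeries.C (ϖ : ℚ_[p]) * iwasawaToPowerSeries p (chromaticL col' Lsharp Lflat) →
        G' ∈ 𝔭.asIdeal) →
      Module.lengthAt (IwasawaAlgebra p) (I.H ⧸ Cs.Z) (PrimeSpectrum.comap (invol p).toRingHom 𝔭) = 0 →
      Module.lengthAt (IwasawaAlgebra p) (I.H ⧸ Cs.Z) 𝔭 ≤ Module.lengthAt (IwasawaAlgebra p) Y.X 𝔭 := by
  intro W _ _ p _ _ _ _ hX κ γ hκ hγ hcv v hv g hg cneg c hH N hN f ϖ Lsharp Lflat hf hϖ hSP I Cs Cf hZ Y 𝔭 h𝔭 hp𝔭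
    hspor hcommon hk'
  refine katoFineLowerSporadic_contra_of_mirrorDoor h3 hdoor W p hX κ γ hκ hγ hcv v hv g hg cneg c hH N hN f ϖ Lsharp Lflat hf hϖ
    hSP I Cs Cf hZ Y 𝔭 h𝔭 hp𝔭 hspor hcommon ?_
  rw [hk']
  exact bot_le

/-- **Instance on the BORN guard pack: door at the mirror ⟹ K at `𝔭`,** with `hdoor := iotaDoorContra_sporadic_of_heldPack_of_thm714 hPT h124 hMatar h714`
(PT functional model, Kato 12.4, Matar 1.1, Sprung Thm. 7.14) and the period unit `h3` — all four/five named facts are printed theorems typed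
statement-only and are exactly the K′ guard's inputs. [cite: Kato2004Asterisque, Thm. 12.4 (p. 221), Conj. 12.10 (p. 224), (17.13.1) (pp. 279–280)]
[cite: Sprung2012, Thm. 7.14 (3) (p. 1504)] [cite: Matar2020, Thm. 1.1] [cite: GreenbergVatsal2000, §3, Remark 3.4] -/
theorem katoFineLowerSporadic_contra_of_mirrorDoor_of_heldPack_of_thm714 (hPT : thm714seq_sharpFlat_poitouTate_functionalModel)
    (h124 : Kato2004.thm12_4) (hMatar : matar2020_thm11_selmerDualTorsion_pseudoIso_fineSelmerDual)
    (h714 : thm714_sharpFlatSelmerDual_finite_torsion) (h3 : realPeriodRat_eq_unit_mul_plusPeriod_three) :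
    ∀ (W : WeierstrassCurve ℚ) [W.IsElliptic] [W.IsGloballyMinimal] (p : ℕ) [Fact p.Prime]
      [ContinuousSMul ℤ_[p] (W.tateModule p)] [Module.Free ℤ_[p] (W.tateModule p)]
      [Module.Finite ℤ_[p] (W.tateModule p)],
      ClassX8 W p → ∀ (κ : ZpExtension ℚ p) (γ : Field.absoluteGaloisGroup ℚ),
      κ.IsCyclotomic → κ.IsTopGenerator γ → IsCyclotomicVariable p γ →
    ∀ (v : HeightOneSpectrum (𝓞 ℚ)), (p : 𝓞 ℚ) ∈ v.asIdeal →
    ∀ (g : Field.absoluteGaloisGroup (v.adicCompletion ℚ)),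
      κ.IsTopGenerator (resGalOfEmb (closureEmb (K := ℚ) (v.adicCompletion ℚ)) g) →
    ∀ (cneg : localPoints W (v.adicCompletion ℚ)) (c : ℕ → localPoints W (v.adicCompletion ℚ)),
      IsHondaSystem κ (closureEmb (K := ℚ) (v.adicCompletion ℚ)) W (W.frobeniusTrace p) g cneg c →
    ∀ (N : ℕ) (_ : NeZero N) (f : CuspForm (Gamma0 N) 2) (ϖ : ℚ) (Lsharp Lflat : IwasawaAlgebra p),
      IsNewformOf W f → (ϖ : ℝ) * W.realPeriodRat = plusPeriod f →
      IsSprungPair f p (W.frobeniusTrace p) Lsharp Lflat →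
    ∀ (I : Kato2004.IwasawaH1Data W p κ γ)
      (Cs : SharpFlatColemanKatoDataContra W p f ϖ κ γ (closureEmb (K := ℚ) (v.adicCompletion ℚ))
        (W.frobeniusTrace p) g c Chroma.sharp I)
      (Cf : SharpFlatColemanKatoDataContra W p f ϖ κ γ (closureEmb (K := ℚ) (v.adicCompletion ℚ))
        (W.frobeniusTrace p) g c Chroma.flat I),
      Cs.Z = Cf.Z →
    ∀ (Y : W.FineSelmerDualData κ γ⁻¹) (𝔭 : PrimeSpectrum (IwasawaAlgebra p)), 𝔭.asIdeal.height = 1 →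
      (p : IwasawaAlgebra p) ∉ 𝔭.asIdeal →
      (¬ ∃ n : ℕ, ((cyclotomicOmega p n).map (Int.castRingHom ℤ_[p]) : PowerSeries ℤ_[p]) ∈ 𝔭.asIdeal) →
      (∀ (col' : Chroma) (G' : IwasawaAlgebra p),
        iwasawaToPowerSeries p G' =
          PowerSeries.C (ϖ : ℚ_[p]) * iwasawaToPowerSeries p (chromaticL col' Lsharp Lflat) →
        G' ∈ 𝔭.asIdeal) →
      Module.lengthAt (IwasawaAlgebra p) (I.H ⧸ Cs.Z) (PrimeSpectrum.comap (invol p).toRingHom 𝔭) ≤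
          min (Module.lengthAt (IwasawaAlgebra p) (IwasawaAlgebra p ⧸ LinearMap.range Cs.colMap) 𝔭)
            (Module.lengthAt (IwasawaAlgebra p) (IwasawaAlgebra p ⧸ LinearMap.range Cf.colMap) 𝔭) →
      Module.lengthAt (IwasawaAlgebra p) (I.H ⧸ Cs.Z) 𝔭 ≤ Module.lengthAt (IwasawaAlgebra p) Y.X 𝔭 :=
  katoFineLowerSporadic_contra_of_mirrorDoor h3 (iotaDoorContra_sporadic_of_heldPack_of_thm714 hPT h124 hMatar h714)

/-- **Instance on the BORN guard pack: a mirror without zeta index ⟹ K at `𝔭`** (`hdoor := iotaDoorContra_sporadic_of_heldPack_of_thm714 …`,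
period unit `h3`). [cite: Kato2004Asterisque, Thm. 12.4 (p. 221), Conj. 12.10 (p. 224), (17.13.1) (pp. 279–280)] [cite: Sprung2012, Thm. 7.14 (3) (p. 1504)]
[cite: Matar2020, Thm. 1.1] [cite: GreenbergVatsal2000, §3, Remark 3.4] -/
theorem katoFineLowerSporadic_contra_of_zeta_comap_invol_eq_zero_of_heldPack_of_thm714
    (hPT : thm714seq_sharpFlat_poitouTate_functionalModel) (h124 : Kato2004.thm12_4)
    (hMatar : matar2020_thm11_selmerDualTorsion_pseudoIso_fineSelmerDual) (h714 : thm714_sharpFlatSelmerDual_finite_torsion)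
    (h3 : realPeriodRat_eq_unit_mul_plusPeriod_three) :
    ∀ (W : WeierstrassCurve ℚ) [W.IsElliptic] [W.IsGloballyMinimal] (p : ℕ) [Fact p.Prime]
      [ContinuousSMul ℤ_[p] (W.tateModule p)] [Module.Free ℤ_[p] (W.tateModule p)]
      [Module.Finite ℤ_[p] (W.tateModule p)],
      ClassX8 W p → ∀ (κ : ZpExtension ℚ p) (γ : Field.absoluteGaloisGroup ℚ),
      κ.IsCyclotomic → κ.IsTopGenerator γ → IsCyclotomicVariable p γ →
    ∀ (v : HeightOneSpectrum (𝓞 ℚ)), (p : 𝓞 ℚ) ∈ v.asIdeal →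
    ∀ (g : Field.absoluteGaloisGroup (v.adicCompletion ℚ)),
      κ.IsTopGenerator (resGalOfEmb (closureEmb (K := ℚ) (v.adicCompletion ℚ)) g) →
    ∀ (cneg : localPoints W (v.adicCompletion ℚ)) (c : ℕ → localPoints W (v.adicCompletion ℚ)),
      IsHondaSystem κ (closureEmb (K := ℚ) (v.adicCompletion ℚ)) W (W.frobeniusTrace p) g cneg c →
    ∀ (N : ℕ) (_ : NeZero N) (f : CuspForm (Gamma0 N) 2) (ϖ : ℚ) (Lsharp Lflat : IwasawaAlgebra p),
      IsNewformOf W f → (ϖ : ℝ) * W.realPeriodRat = plusPeriod f →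
      IsSprungPair f p (W.frobeniusTrace p) Lsharp Lflat →
    ∀ (I : Kato2004.IwasawaH1Data W p κ γ)
      (Cs : SharpFlatColemanKatoDataContra W p f ϖ κ γ (closureEmb (K := ℚ) (v.adicCompletion ℚ))
        (W.frobeniusTrace p) g c Chroma.sharp I)
      (Cf : SharpFlatColemanKatoDataContra W p f ϖ κ γ (closureEmb (K := ℚ) (v.adicCompletion ℚ))
        (W.frobeniusTrace p) g c Chroma.flat I),
      Cs.Z = Cf.Z →
    ∀ (Y : W.FineSelmerDualData κ γ⁻¹) (𝔭 : PrimeSpectrum (IwasawaAlgebra p)), 𝔭.asIdeal.height = 1 →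
      (p : IwasawaAlgebra p) ∉ 𝔭.asIdeal →
      (¬ ∃ n : ℕ, ((cyclotomicOmega p n).map (Int.castRingHom ℤ_[p]) : PowerSeries ℤ_[p]) ∈ 𝔭.asIdeal) →
      (∀ (col' : Chroma) (G' : IwasawaAlgebra p),
        iwasawaToPowerSeries p G' =
          PowerSeries.C (ϖ : ℚ_[p]) * iwasawaToPowerSeries p (chromaticL col' Lsharp Lflat) →
        G' ∈ 𝔭.asIdeal) →
      Module.lengthAt (IwasawaAlgebra p) (I.H ⧸ Cs.Z) (PrimeSpectrum.comap (invol p).toRingHom 𝔭) = 0 →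
      Module.lengthAt (IwasawaAlgebra p) (I.H ⧸ Cs.Z) 𝔭 ≤ Module.lengthAt (IwasawaAlgebra p) Y.X 𝔭 :=
  katoFineLowerSporadic_contra_of_zeta_comap_invol_eq_zero h3 (iotaDoorContra_sporadic_of_heldPack_of_thm714 hPT h124 hMatar h714)

end Summit.BirchSwinnertonDyer.BirchSwinnertonDyer.Theorems.ChromaticCommonZeros

end
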